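import Summits.Langlands.Langlands.Theses.QuarterDeficit1951

/-!
# Route `QuarterDeficit1951` (Langlands) — crux `CensusDecoding` (stmt-Langlands-17935)

Settles the decoding glue of the refutation-shaped route `QuarterDeficit1951`:

  `CensusDecoding := CensusDeficit1951 → WindowFormDictionary → QuarterFingerprintDeficit`.

Proof (crux idea `direct-decoding`, Cruxes/CensusDecoding/Ideas/direct-decoding.md): unpack a
hypothetical fingerprinted window form `u` for an order-5 character `χ`; `WindowFormDictionary`
upgrades the route's inlined Maass predicate to the census semantics
`IsMaassCuspFormOn 1951 χ u λ`; the pointwise inlined `T_p`-relations are packaged into ONE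
eigenvalue function `μ : ℕ → ℂ` with `maassHeckeOp 1951 χ p u = μ p • u` through
`maassHeckeOp_prime` (`heckeEigen_of_pointwise`); decoding theorem I
`MaassHeckeTraceCensus.not_fingerprinted` on the certified deficit transcript of `CensusDeficit1951`
returns a transcript prime `p ∈ fpPrimes ⊆ {2,3,5,7,11,13}` at which `‖μ_p²·χ̄(p) − φ‖ > fpTol ≥ 1/100`
for EVERY `φ ∈ Φ` (`icosahedralFingerprint` is the route's `Φ` verbatim), contradicting the assumed
`≤ 1/100`; the window matches because `|λ − 1/4| ≤ 1/100 ≤ window`. The parametric form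
`pointwiseDeficit_of_census` (any level, window, tolerance, prime list) carries the argument; the
crux is its instantiation. Stated against the route decl BY NAME so that the gate closes the item.
-/

set_option linter.dupNamespace false -- project-wide option; `Summit.Langlands.Langlands` is the mandated namespace

namespace Summit.Langlands.Langlands.Theorems.QuarterDeficit1951

open Literature.NumberTheory.Automorphic
open Summit.Langlands.Langlands.Theses.QuarterDeficit1951

/-- **Packaging of pointwise Hecke relations.** Pointwise `T_p`-eigen-relations in the inlined
route shape (`maassHeckeOp_prime`), one `∃ μ` per prime of a list `P` of primes, each carrying a
side property `Q p μ`, give one eigenvalue function `μ : ℕ → ℂ` with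
`maassHeckeOp N χ p u = μ p • u` and `Q p (μ p)` on `P`. [folklore] -/
theorem heckeEigen_of_pointwise {N : ℕ} (χ : DirichletCharacter ℂ N) (u : UpperHalfPlane → ℂ)
    (P : List ℕ) (hP : ∀ p ∈ P, p.Prime) (Q : ℕ → ℂ → Prop)
    (h : ∀ p ∈ P, ∃ μ : ℂ, (∀ z : UpperHalfPlane,
      ((Real.sqrt p : ℝ) : ℂ)⁻¹ * ((∑ b ∈ Finset.range p,
          u (UpperHalfPlane.ofComplex (((z : ℂ) + b) / p))) +
        χ (p : ZMod N) * u (UpperHalfPlane.ofComplex ((p : ℂ) * z))) = μ * u z) ∧ Q p μ) :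
    ∃ μ : ℕ → ℂ, (∀ p ∈ P, maassHeckeOp N χ p u = μ p • u) ∧ ∀ p ∈ P, Q p (μ p) := by
  classical
  choose! μ hT hQ using h
  refine ⟨μ, fun p hp => ?_, hQ⟩
  funext z
  rw [Pi.smul_apply, smul_eq_mul, maassHeckeOp_prime N χ (hP p hp) u z]
  exact hT p hp z

/-- **Parametric decoding (deficit).** For any level `N`, character `χ`, certified deficit census
`c` for `(N, χ)` whose fingerprint primes are prime, and real window `w ≤ c.window`, tolerance
`t ≤ c.fpTol`: there is no non-zero weight-`0` Maass cusp form on `(Γ₀(N), χ)` with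
`|λ − 1/4| ≤ w` that is a pointwise `T_p`-eigenfunction (inlined shape) at every transcript prime
with `λ_p²·χ̄(p)` within `t` of `Φ`. [cite: BookerLeeStrombergsson2020, §5] -/
theorem pointwiseDeficit_of_census {N : ℕ} {χ : DirichletCharacter ℂ N}
    {c : MaassHeckeTraceCensus} (hcert : CertifiedMaassHeckeTraceCensus N χ c)
    (hdef : c.certifiesDeficit = true) (hprime : ∀ p ∈ c.fpPrimes, p.Prime)
    {w t : ℝ} (hw : w ≤ (c.window : ℝ)) (ht : t ≤ (c.fpTol : ℝ))
    {u : UpperHalfPlane → ℂ} {lam : ℝ} (hu : IsMaassCuspFormOn N χ u lam) (hne : ∃ z, u z ≠ 0)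
    (hwin : |lam - 1 / 4| ≤ w)
    (hfp : ∀ p ∈ c.fpPrimes, ∃ μ φ : ℂ, φ ∈ icosahedralFingerprint ∧
      (∀ z : UpperHalfPlane, ((Real.sqrt p : ℝ) : ℂ)⁻¹ * ((∑ b ∈ Finset.range p,
          u (UpperHalfPlane.ofComplex (((z : ℂ) + b) / p))) +
        χ (p : ZMod N) * u (UpperHalfPlane.ofComplex ((p : ℂ) * z))) = μ * u z) ∧
      ‖μ ^ 2 * (starRingEnd ℂ) (χ (p : ZMod N)) - φ‖ ≤ t) : False := by
  obtain ⟨μ, hT, hQ⟩ := heckeEigen_of_pointwise χ u c.fpPrimes hprime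
    (fun p μ => ∃ φ ∈ icosahedralFingerprint, ‖μ ^ 2 * (starRingEnd ℂ) (χ (p : ZMod N)) - φ‖ ≤ t)
    (fun p hp => by
      obtain ⟨μ, φ, hφ, hT, hle⟩ := hfp p hp
      exact ⟨μ, hT, φ, hφ, hle⟩)
  obtain ⟨p, hp, hviol⟩ :=
    MaassHeckeTraceCensus.not_fingerprinted hcert hdef hu hne (hwin.trans hw) hT
  obtain ⟨φ, hφ, hle⟩ := hQ p hp
  have hlt := hviol φ hφ
  linarith

/-- The six fingerprint primes of the route are prime. [folklore] -/
theorem prime_of_mem_fingerprintPrimes : ∀ p ∈ ({2, 3, 5, 7, 11, 13} : Finset ℕ), p.Prime := by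
  decide

/-- **Crux `CensusDecoding` of route QuarterDeficit1951** (item stmt-Langlands-17935):
`CensusDeficit1951 → WindowFormDictionary → QuarterFingerprintDeficit`.
[cite: BookerLeeStrombergsson2020, §5] -/
theorem CensusDecoding_proof :
    Summit.Langlands.Langlands.Theses.QuarterDeficit1951.CensusDecoding := by
  intro hcensus hdict
  show QuarterFingerprintDeficit
  unfold QuarterFingerprintDeficit
  dsimp only
  intro χ hχ
  rintro ⟨u, lam, ⟨hC2, heig, hslash, hcusp1, hcusp0, hbdd⟩, hne, hwin, hfp⟩
  obtain ⟨c, hw, ht, hprimes, hcert, hdef⟩ := hcensus χ hχ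
  have hu : IsMaassCuspFormOn 1951 χ u lam := hdict χ u lam hC2 heig hslash hcusp1 hcusp0 hbdd
  have hw' : (1 / 100 : ℝ) ≤ (c.window : ℝ) := by
    have h := (Rat.cast_le (K := ℝ)).mpr hw; push_cast at h; linarith
  have ht' : (1 / 100 : ℝ) ≤ (c.fpTol : ℝ) := by
    have h := (Rat.cast_le (K := ℝ)).mpr ht; push_cast at h; linarith
  exact pointwiseDeficit_of_census hcert hdef
    (fun p hp => prime_of_mem_fingerprintPrimes p (hprimes p hp))
    hw' ht' hu hne hwin (fun p hp => hfp p (hprimes p hp))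

end Summit.Langlands.Langlands.Theorems.QuarterDeficit1951
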